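import Summits.Ventures.CertifiedManyBodySolver.Observables.PhaseSeparationExclusionBoxLayered
import Summits.Ventures.CertifiedManyBodySolver.Observables.PhaseSeparationExclusionBoxZeeman
import HarnessLib

/-!
# Ventures/CertifiedManyBodySolver — Observables/PhaseSeparationExclusionBoxLayeredTcap.lean: the INTERLAYER (c-axis) competing-order cell forms with a
# `t′`-AFFINE CAP `c₀ + c_s·s + c₁·U` and (at `T > 0`) `s`-DEPENDENT anchors — 3D layered crystal `layeredHubbardTTPrime t s U w tz`, `T = 0` and `T > 0`

HONEST FRAMING: a transport device; the `c_s ≠ 0` / anchor-function editions of `psL_not_layeredGroundState_mix_on_cell_of_columns` and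
`psLT_not_layeredEquilibrium_mix_on_cell_of_columns_hotAnchor` (g21): at fixed `s` the cap `c₀ + c_s s + c₁ U` is the `U`-affine cap `(c₀ + c_s s) + c₁ U`, so the g21
algebra (`uchord_pos_of_ends`, `hotAnchor_chord_slack`) applies verbatim with `c₀ ↦ c₀ + c_s s`, `π_i ↦ Q_i(s)`. Laws (this seat, g21; `Literature/…/HubbardTTPrimePhaseCoexistenceExclusionLayered.lean`):
`IsTranslationInvariant.layeredGroundEnergy_lt_meanEnergy_mix_of_cap_lt_floors_of_cost_le` (`T = 0`) and `…sub_mul_layered_lt_varPressureAt_mix_of_hotAnchors_of_threshold_of_cost_le`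
(`T > 0`): 2D cap / floors / anchors with margin `M` exclude the `(≤ n₁ | ≥ n₂)` coexistence in the layered crystal for every stacking with `(4/π)Σ_b|t_{z,b}| ≤ k` once
`M > k` (`T = 0`) / the anchored inequality holds with `M − k` (`T > 0`). Needed by the MID-SEGMENT-CAP words (this seat g26; cap = the registry's `t′`-affine filling-`1/2`
plane r468, dilute anchor = a `t′`-chord of kernel free-gas ceilings): their margins `0.13–0.30` exceed the La₂CuO₄ bct interlayer cost `κ ≈ 0.09·t` that no earlier margin
(`0.035–0.05`) covered (PS-MENU §8 honest limit). CONTROL class; `κ` is the crude linear kinematic cost; conditional on whatever nodes an instance names; nothing about SC or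
`T_c`; no number of record. Zero kit, no definition, no claim node.

Cell `pub/hubbard-downfold` (MO-S1 filling lane; D-0096 (iii) interlayer coupling), seat `hubbard-downfold-unc-2` (g26), 2026-08-29.
References: R. B. Israel (1979) Thm I.2.4 [Israel1979]; O. Bratteli, A. Kishimoto, D. W. Robinson, CMP 64 (1978) 41 [BratteliKishimotoRobinson1978];
D. Poulin, M. B. Hastings, PRL 106 (2011) 080403 [PoulinHastings2011].
-/

noncomputable section

namespace Summit.Ventures.CertifiedManyBodySolver.Observables

open Literature.MathematicalPhysics.QuantumLattice Literature.MathematicalPhysics.QuantumLattice.ThermodynamicLimit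
open Literature.MathematicalPhysics.QuantumLattice.InfVolFermionState Set Filter
open Literature.Probability.LatticeModels HubbardWave0
open scoped BigOperators

/-! ## §1 `T = 0`: ground states of the layered crystal on a cell, `t′`-affine cap -/

/-- **LAYERED-CRYSTAL PS EXCLUSION ON A CELL, `T = 0`, COLUMN FORM, CAP AFFINE IN `(s, U)`** (as `psL_not_layeredGroundState_mix_on_cell_of_columns` with the
cap `c₀ + c_s s + c₁ U` and the column margins `c₀ + c_s s + c₁U_i + k < aF₁(s) + bL_i(s)`): at every `(s, U)` of the cell and for every stacking with
`(4/π)Σ_b|tz_b| ≤ k`, no `(≤ n₁ | ≥ n₂)` mixture of translation-invariant states on `ℤ³` is a ground state of `layeredHubbardTTPrime t s U w tz` at its filling.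
[cite: Israel1979, Thm. I.2.4] [cite: BratteliKishimotoRobinson1978, Thm. 2 (condition 2)] -/
theorem psL_not_layeredGroundState_mix_on_cell_of_columns_tcap (t : ℝ) {κ : Type*} [Fintype κ] {w : κ → Site 3}
    (hw : ∀ b, w b 0 ≠ 0) (tz : κ → ℝ) {R' : ℝ} (hR' : 1 ≤ R') (hwR' : ∀ b, w b ∈ thicken ({0} : Finset (Site 3)) R')
    {s₁ s₂ U₁ U₂ n₁ n₂ a b c₀ cs c₁ k : ℝ} (hU₁ : 0 ≤ U₁) (h12 : U₁ < U₂) (hn₁ : 0 ≤ n₁) (hn : n₁ < n₂) (hn₂ : n₂ < 2)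
    (ha : 0 ≤ a) (hb : 0 ≤ b) (hab : a + b = 1) {L₁ L₂ F₁ : ℝ → ℝ}
    (hC : ∀ s ∈ Icc s₁ s₂, ∀ U ∈ Icc U₁ U₂, energyDensityTT' t s U (a * n₁ + b * n₂) ≤ c₀ + cs * s + c₁ * U)
    (hL₁ : ∀ s ∈ Icc s₁ s₂, L₁ s ≤ energyDensityTT' t s U₁ n₂) (hL₂ : ∀ s ∈ Icc s₁ s₂, L₂ s ≤ energyDensityTT' t s U₂ n₂)
    (hF₁ : ∀ s ∈ Icc s₁ s₂, ∀ U ∈ Icc U₁ U₂, F₁ s ≤ energyDensityTT' t s U n₁)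
    (hk : 4 / Real.pi * ∑ b, |tz b| ≤ k)
    (hm₁ : ∀ s ∈ Icc s₁ s₂, c₀ + cs * s + c₁ * U₁ + k < a * F₁ s + b * L₁ s)
    (hm₂ : ∀ s ∈ Icc s₁ s₂, c₀ + cs * s + c₁ * U₂ + k < a * F₁ s + b * L₂ s)
    {s : ℝ} (hs : s ∈ Icc s₁ s₂) {U : ℝ} (hU : U ∈ Icc U₁ U₂)
    {ω₁ ω₂ : InfVolFermionState 3} (h₁ : ω₁.IsTranslationInvariant) (h₂ : ω₂.IsTranslationInvariant)
    (hρ₁ : 0 < ω₁.density) (hρ₁' : ω₁.density ≤ n₁) (hρ₂ : n₂ ≤ ω₂.density) (hρ₂' : ω₂.density < 2)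
    {lam : ℝ} (hl0 : 0 < lam) (hl1 : lam < 1) :
    (layeredHubbardTTPrime t s U w tz).tiGroundEnergyDensityAt R' (mix lam hl0.le hl1.le ω₁ ω₂).density <
      (mix lam hl0.le hl1.le ω₁ ω₂).meanEnergy (layeredHubbardTTPrime t s U w tz) R' := by
  have hn2' : 0 ≤ n₂ := hn₁.trans hn.le
  have hF₂ := floor_on_cell_of_columnLaws t hn2' hn₂ hU₁ h12 hL₁ hL₂ s hs U hU
  refine h₁.layeredGroundEnergy_lt_meanEnergy_mix_of_cap_lt_floors_of_cost_le t s (hU₁.trans hU.1) hw tz hR' hwR' h₂ hρ₁ hρ₂' hρ₁'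
    hn hρ₂ ha hb hab (hC s hs U hU) (hF₁ s hs U hU) hF₂ hk ?_ hl0 hl1
  have hpos := uchord_pos_of_ends h12 hU (sub_pos.2 (hm₁ s hs)) (sub_pos.2 (hm₂ s hs))
  have hd : (U₂ - U₁) ≠ 0 := (sub_pos.2 h12).ne'
  have hid : a * F₁ s + b * (((U₂ - U) * L₁ s + (U - U₁) * L₂ s) / (U₂ - U₁)) - (c₀ + cs * s + c₁ * U + k) =
      ((U₂ - U) * (a * F₁ s + b * L₁ s - (c₀ + cs * s + c₁ * U₁ + k)) +
        (U - U₁) * (a * F₁ s + b * L₂ s - (c₀ + cs * s + c₁ * U₂ + k))) / (U₂ - U₁) := by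
    field_simp
    ring
  have h := hid ▸ hpos
  linarith

/-! ## §2 `T > 0`: canonical equilibrium states of the layered crystal, column × threshold form, `s`-dependent anchors, `t′`-affine cap -/

/-- **LAYERED-CRYSTAL THERMAL PS EXCLUSION ON A CELL, COLUMN × THRESHOLD FORM, CAP AFFINE IN `(s, U)`, `s`-DEPENDENT ANCHORS `Q₁(s)`, `Q₂(s)`** (as
`psLT_not_layeredEquilibrium_mix_on_cell_of_columns_hotAnchor` with the cap `c₀ + c_s s + c₁ U` and anchor functions): at every `(s, U)` of the cell, every `β ≥ β₀`
and every stacking with `(4/π)Σ_b|tz_b| ≤ k`, no `(≤ n₁ | ≥ n₂)` mixture of translation-invariant states on `ℤ³` is a canonical equilibrium state of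
`layeredHubbardTTPrime t s U w tz`. [cite: Israel1979, Thm. I.2.4] [cite: PoulinHastings2011, eqs. (3)–(8)] [cite: BratteliKishimotoRobinson1978, Thm. 2 (condition 2)] -/
theorem psLT_not_layeredEquilibrium_mix_on_cell_of_columns_hotAnchorSS_tcap (t : ℝ) {κ : Type*} [Fintype κ] {w : κ → Site 3}
    (hw : ∀ b, w b 0 ≠ 0) (tz : κ → ℝ) {R' : ℝ} (hR' : 1 ≤ R') (hwR' : ∀ b, w b ∈ thicken ({0} : Finset (Site 3)) R')
    {s₁ s₂ U₁ U₂ n₁ n₂ a b c₀ cs c₁ β β₀ βh₁ βh₂ k : ℝ}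
    (hU₁ : 0 ≤ U₁) (h12 : U₁ < U₂) (hn₁ : 0 ≤ n₁) (hn : n₁ < n₂) (hn₂ : n₂ < 2) (ha : 0 ≤ a) (hb : 0 ≤ b)
    (hab : a + b = 1) (hβh₁ : 0 ≤ βh₁) (hβh₂ : 0 ≤ βh₂) (h0₁ : βh₁ ≤ β₀) (h0₂ : βh₂ ≤ β₀) (hβ₀ : β₀ ≤ β)
    (hβ₀pos : 0 < β₀) {L₁ L₂ F₁ Q₁ Q₂ : ℝ → ℝ}
    (hC : ∀ s ∈ Icc s₁ s₂, ∀ U ∈ Icc U₁ U₂, energyDensityTT' t s U (a * n₁ + b * n₂) ≤ c₀ + cs * s + c₁ * U)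
    (hL₁ : ∀ s ∈ Icc s₁ s₂, L₁ s ≤ energyDensityTT' t s U₁ n₂) (hL₂ : ∀ s ∈ Icc s₁ s₂, L₂ s ≤ energyDensityTT' t s U₂ n₂)
    (hF₁ : ∀ s ∈ Icc s₁ s₂, ∀ U ∈ Icc U₁ U₂, F₁ s ≤ energyDensityTT' t s U n₁)
    (hπ₁ : ∀ s ∈ Icc s₁ s₂, ∀ U ∈ Icc U₁ U₂, pressureTT' βh₁ t s U n₁ ≤ Q₁ s)
    (hπ₂ : ∀ s ∈ Icc s₁ s₂, ∀ U ∈ Icc U₁ U₂, pressureTT' βh₂ t s U n₂ ≤ Q₂ s)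
    (hk : 4 / Real.pi * ∑ b, |tz b| ≤ k)
    (hm₁ : ∀ s ∈ Icc s₁ s₂, 0 ≤ a * F₁ s + b * L₁ s - (c₀ + cs * s + c₁ * U₁) - k)
    (hm₂ : ∀ s ∈ Icc s₁ s₂, 0 ≤ a * F₁ s + b * L₂ s - (c₀ + cs * s + c₁ * U₂) - k)
    (hg₁ : ∀ s ∈ Icc s₁ s₂, a * Q₁ s + b * Q₂ s + βh₁ * (a * F₁ s) + βh₂ * (b * L₁ s) <
      β₀ * (a * F₁ s + b * L₁ s - (c₀ + cs * s + c₁ * U₁) - k))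
    (hg₂ : ∀ s ∈ Icc s₁ s₂, a * Q₁ s + b * Q₂ s + βh₁ * (a * F₁ s) + βh₂ * (b * L₂ s) <
      β₀ * (a * F₁ s + b * L₂ s - (c₀ + cs * s + c₁ * U₂) - k))
    {s : ℝ} (hs : s ∈ Icc s₁ s₂) {U : ℝ} (hU : U ∈ Icc U₁ U₂)
    {ω₁ ω₂ : InfVolFermionState 3} (h₁ : ω₁.IsTranslationInvariant) (h₂ : ω₂.IsTranslationInvariant)
    (hρ₁ : 0 < ω₁.density) (hρ₁' : ω₁.density ≤ n₁) (hρ₂ : n₂ ≤ ω₂.density) (hρ₂' : ω₂.density < 2)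
    {lam : ℝ} (hl0 : 0 < lam) (hl1 : lam < 1) :
    (mix lam hl0.le hl1.le ω₁ ω₂).entropyDensitySup -
        β * (mix lam hl0.le hl1.le ω₁ ω₂).meanEnergy (layeredHubbardTTPrime t s U w tz) R' <
      (layeredHubbardTTPrime t s U w tz).varPressureAt β R' (mix lam hl0.le hl1.le ω₁ ω₂).density := by
  have hn2' : 0 ≤ n₂ := hn₁.trans hn.le
  have hβpos : 0 < β := hβ₀pos.trans_le hβ₀
  have hF₂ := floor_on_cell_of_columnLaws t hn2' hn₂ hU₁ h12 hL₁ hL₂ s hs U hU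
  obtain ⟨hMnn, hM₀⟩ := hotAnchor_chord_slack (c₀ := c₀ + cs * s) (βh₁ := βh₁) (βh₂ := βh₂) (π₁ := Q₁ s) (π₂ := Q₂ s) h12 hU
    (hm₁ s hs) (hm₂ s hs) (hg₁ s hs) (hg₂ s hs)
  exact h₁.sub_mul_layered_lt_varPressureAt_mix_of_hotAnchors_of_threshold_of_cost_le t s (hU₁.trans hU.1) hβpos hw tz hR' hwR'
    h₂ hρ₁ hρ₂' hρ₁' hn hρ₂ ha hb hab (hC s hs U hU) (hF₁ s hs U hU) hF₂ hβh₁ hβh₂ h0₁ h0₂ hβ₀ (hπ₁ s hs U hU) (hπ₂ s hs U hU)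
    hk hMnn hM₀ hl0 hl1

end Summit.Ventures.CertifiedManyBodySolver.Observables

end
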